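import Mathlib
import HarnessLib
import Summits.HubbardSuperconductivity.HubbardSuperconductivity.Theorems.KLProgrammeKLRegimeSplitPhRotationPlanarWeighted
import Summits.HubbardSuperconductivity.HubbardSuperconductivity.Theorems.KLProgrammeKLRegimeSplitPhRotationLattice

/-!
# Route `KLProgramme` — ENGINE (stmt-HubbardSuperconductivity-20437 `KLRegimeEngineV17F2`), row (c) binder #8 (★ v19 `hexLadMV`, value rows `RP RQ`), brick O6i-b:
# THE ANGULARLY WEIGHTED ROTATION LEMMA ON THE MODEL CARRIER `MatsubaraIdx M × TorusSite 2 L` — O6i-a's planar bound `B_v·𝔅₆ₐ` + the lattice Riemann rate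
# `(r₂/π + 3/β)·2π·K_w/L`, `K_w = B_w·(2r₂L⋆(4 + 2A)) + L_w·(M_G/r₁²)`
# (cell gate-hubbard-kl, seat hubbard-kl-k3c2-p2 g32, technique «thermal-bar induction n ≤ nScales β + 1 with EngineBoundsAtV4S sums»)

WHY.  O6b (`klph_lattice_rotation_le`) carries the UNWEIGHTED planar rotation lemma to the torus momenta with the lane's Riemann device
`klfl_matsubara_latticeAverage_norm_le`; O6i-a (`klpw_planar_rotation_weighted_le`) is the planar lemma with an ANGULAR WEIGHT `w` (radially constant in the C4a chart,
`w(levelChart(ρ,ϑ)) = v(ϑ)`), which is what lets the frozen kernel product of binder #8's `RP/RQ` depend on the Fermi-surface angle (this seat's CAVEAT 05:15Z).  This file is the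
lattice twin: the per-frequency planar integrand `p ↦ w(p)·f(ω_i, e_K(p))` is continuous, doubly `2π`-periodic and Lipschitz with constant `K_w = B_w·K_f + L_w·(M_G/r₁²)`
(`K_f = 2r₂L⋆(4 + 2A)` from O6b) as soon as `w` is continuous, doubly periodic, `L_w`-Lipschitz and `|w| ≤ B_w` (hypotheses; the consumer builds `w` from the angular profile of its
frozen kernel product — any planar extension that is radially constant across the shell), and it vanishes off the tube, so the square integral is the tube integral.

* `klpw_F_lipschitz` — `|w(p)f(ω,e_K(p)) − w(q)f(ω,e_K(q))| ≤ (B_w·K_f + L_w·M_G/r₁²)·dist p q`;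
* `klpw_integral_square_weighted_eq_tube` — `∫_{[−π,π]²} w·f(ω,e_K) = ∫_{tube} w·f(ω,e_K)`;
* **`klpw_lattice_rotation_weighted_le`** — `|β⁻¹ Σ_i (L²)⁻¹ Σ_k̃ w(p_k̃)·f(ω_i, e_K(p_k̃))| ≤ (2π)⁻²·B_v·𝔅₆ₐ + (r₂/π + 3/β)·(2π·K_w/L)`, `p_k̃ = latticeMomentum`,
  `e_K(p_k̃) = nambuXiCT L μ K k̃`.
Pure composition; no definitions; nothing asserts (c), K3 or superconductivity.  [cite: BenfattoGiulianiMastropietro2006, §2.4–§2.5]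
-/

noncomputable section

namespace Summit.HubbardSuperconductivity.HubbardSuperconductivity.Theorems.KLRegimeSplit

set_option linter.dupNamespace false -- summit = problem name (single-conjunct summit), D-0017

open Real Set Finset MeasureTheory Literature.MathematicalPhysics.QuantumLattice Literature.Probability.LatticeModels
open Literature.MathematicalPhysics.QuantumLattice.BandSectorCounting
open Summit.HubbardSuperconductivity.HubbardSuperconductivity.Theorems.TwoPointAssembly
open Summit.HubbardSuperconductivity.HubbardSuperconductivity.Theorems.EngineV8
open Summit.HubbardSuperconductivity.HubbardSuperconductivity.Theorems.DispersionFlow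
open Summit.HubbardSuperconductivity.HubbardSuperconductivity.Theorems.PerturbedFermiCurve
open Summit.HubbardSuperconductivity.HubbardSuperconductivity.Theorems.C4a

section Chart

variable {a b : ℝ} (B : BandBounds a b) {K : TrigPolyC4v} {A : ℝ}
  (hA : ∀ p : Momentum, ∀ j ≤ 2, ‖iteratedFDeriv ℝ j (frameShift K) p‖ ≤ A) (hADt : 2 * A < B.Dtmin)
  {μ r : ℝ} (hlo : a < μ - r - A) (hhi : μ + r + A < b)
include B hA hADt hlo hhi

omit B hA hADt hlo hhi in
/-- **The square integral of the weighted planar integrand is its tube integral** (the slice weight vanishes off the shell `|e_K| < r₂ < r`). -/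
theorem klpw_integral_square_weighted_eq_tube {G : ℝ → ℝ} {r₂ : ℝ} (hout : ∀ s, r₂ ^ 2 ≤ s → G s = 0) (hr₂ : 0 ≤ r₂) (hr₂r : r₂ < r) (w : ℝ × ℝ → ℝ) (ω : ℝ) :
    ∫ p in Icc (-π) π ×ˢ Icc (-π) π, w p * (G (ω ^ 2 + frameLevel μ K (WithLp.toLp 2 ![p.1, p.2]) ^ 2) * (frameLevel μ K (WithLp.toLp 2 ![p.1, p.2]) ^ 2 - ω ^ 2) /
        (ω ^ 2 + frameLevel μ K (WithLp.toLp 2 ![p.1, p.2]) ^ 2) ^ 2) =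
      ∫ q in {q : ℝ × ℝ | |q.1| < π ∧ |q.2| < π ∧ |frameLevel μ K (WithLp.toLp 2 ![q.1, q.2])| < r},
        w q * (G (ω ^ 2 + frameLevel μ K (WithLp.toLp 2 ![q.1, q.2]) ^ 2) * (frameLevel μ K (WithLp.toLp 2 ![q.1, q.2]) ^ 2 - ω ^ 2) /
          (ω ^ 2 + frameLevel μ K (WithLp.toLp 2 ![q.1, q.2]) ^ 2) ^ 2) := by
  have hopen : {q : ℝ × ℝ | |q.1| < π ∧ |q.2| < π ∧ |frameLevel μ K (WithLp.toLp 2 ![q.1, q.2])| < r} ⊆ Ioo (-π) π ×ˢ Ioo (-π) π :=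
    fun q hq => mk_mem_prod (abs_lt.1 hq.1) (abs_lt.1 hq.2.1)
  have hae : (Ioo (-π) π ×ˢ Ioo (-π) π : Set (ℝ × ℝ)) =ᵐ[volume] (Icc (-π) π ×ˢ Icc (-π) π : Set (ℝ × ℝ)) := by
    rw [Measure.volume_eq_prod]
    exact Measure.set_prod_ae_eq (Ioo_ae_eq_Icc (μ := (volume : Measure ℝ))) (Ioo_ae_eq_Icc (μ := (volume : Measure ℝ)))
  rw [← setIntegral_congr_set hae, setIntegral_eq_of_subset_of_forall_sdiff_eq_zero (measurableSet_Ioo.prod measurableSet_Ioo) hopen]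
  intro q hq
  have hq1 : |q.1| < π := abs_lt.2 (mem_prod.1 hq.1).1
  have hq2 : |q.2| < π := abs_lt.2 (mem_prod.1 hq.1).2
  have hnot : ¬ |frameLevel μ K (WithLp.toLp 2 ![q.1, q.2])| < r := fun h => hq.2 ⟨hq1, hq2, h⟩
  rw [klph_f_zero_of_level hout hr₂ ω ((le_of_lt hr₂r).trans (not_lt.1 hnot)), mul_zero]

/-- **THE ANGULARLY WEIGHTED ROTATION LEMMA ON THE TORUS MOMENTA.**  Under the hypotheses of `klpw_planar_rotation_weighted_le` (C4a chart, slice weight `G`, `0 < r₂ < r`,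
`0 < β`, `βr₂/(2π) + 1 ≤ M`, angular weight data `w, v, B_v` with `w(levelChart(ρ,ϑ)) = v(ϑ)`), and a planar weight `w` that is moreover continuous, doubly `2π`-periodic,
`L_w`-Lipschitz (sup metric) and bounded by `B_w`: for every `L`,
`|β⁻¹ Σ_i (L²)⁻¹ Σ_k̃ w(p_k̃)·f(ω_i, e_K(p_k̃))| ≤ (2π)⁻²·B_v·𝔅₆ₐ + (r₂/π + 3/β)·(2π·(B_w·(2r₂L⋆(4 + 2A)) + L_w·(M_G/r₁²))/L)`.
[cite: BenfattoGiulianiMastropietro2006, §2.4–§2.5] -/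
theorem klpw_lattice_rotation_weighted_le {M : ℕ} {β : ℝ} (hβ : 0 < β) {G : ℝ → ℝ} {Mg ℓ r₁ r₂ : ℝ} (hbd : ∀ s, |G s| ≤ Mg)
    (hlip : ∀ s s', |G s - G s'| ≤ ℓ * |s - s'|) (hin : ∀ s, s ≤ r₁ ^ 2 → G s = 0) (hout : ∀ s, r₂ ^ 2 ≤ s → G s = 0)
    (hr₁ : 0 < r₁) (hr₂ : 0 < r₂) (hr₂r : r₂ < r) (hM : β * r₂ / (2 * Real.pi) + 1 ≤ M)
    (w : ℝ × ℝ → ℝ) (v : ℝ → ℝ) (hvm : Measurable v) (hvp : Function.Periodic v (2 * π)) {Bv : ℝ} (hvb : ∀ ϑ, |v ϑ| ≤ Bv)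
    (hw : ∀ p : ℝ × ℝ, p.1 ∈ Ioo (-r) r → w (levelChart μ K p) = v p.2)
    (hwc : Continuous w) (hw1 : ∀ x y, w (x + 2 * π, y) = w (x, y)) (hw2 : ∀ x y, w (x, y + 2 * π) = w (x, y))
    {Lw Bw : ℝ} (hLw : 0 ≤ Lw) (hwlip : ∀ p q : ℝ × ℝ, |w p - w q| ≤ Lw * dist p q) (hwb : ∀ p, |w p| ≤ Bw) (L : ℕ) [NeZero L] :
    |β⁻¹ * ∑ i : MatsubaraIdx M, ((L ^ 2 : ℕ) : ℝ)⁻¹ * ∑ k : TorusSite 2 L,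
        w (latticeMomentum L k 0, latticeMomentum L k 1) *
          (G (matsubaraFreq β M i ^ 2 + nambuXiCT L μ K k ^ 2) * (nambuXiCT L μ K k ^ 2 - matsubaraFreq β M i ^ 2) /
            (matsubaraFreq β M i ^ 2 + nambuXiCT L μ K k ^ 2) ^ 2)| ≤
      ((2 * π) ^ 2)⁻¹ * (Bv * (2 * π * (π * Real.sqrt 2 / (B.Dtmin - 2 * A)) *
            ((2 * r₂ * (2 * r₂ * (2 * r₂ ^ 2 * (ℓ / r₁ ^ 4 + 2 * Mg / r₁ ^ 6) + (ℓ / r₁ ^ 2 + Mg / r₁ ^ 4)))) * (r₂ + 2 * Real.pi / β) / β) +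
          β⁻¹ * ((r₂ * β / π + 1) * (2 * r₂ * (2 * π * (1 / (B.Dtmin - 2 * A) ^ 2 + Real.pi * Real.sqrt 2 * (2 + 4 * A) / (B.Dtmin - 2 * A) ^ 3) * r₂ *
            (Mg / r₁ ^ 2)))))) +
        (r₂ / π + 3 / β) * (2 * π * (Bw * (2 * r₂ * (2 * r₂ ^ 2 * (ℓ / r₁ ^ 4 + 2 * Mg / r₁ ^ 6) + (ℓ / r₁ ^ 2 + Mg / r₁ ^ 4)) * (4 + 2 * A)) +
          Lw * (Mg / r₁ ^ 2)) / L) := by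
  have hπ := Real.pi_pos
  have hA0 : 0 ≤ A := le_trans (norm_nonneg _) (hA 0 0 (by norm_num))
  have hMg : 0 ≤ Mg := (abs_nonneg _).trans (hbd 0)
  have hBw : 0 ≤ Bw := (abs_nonneg _).trans (hwb 0)
  have hℓ : 0 ≤ ℓ := by
    have h := hlip 0 1; have h0 : 0 ≤ |G 0 - G 1| := abs_nonneg _; norm_num at h; linarith
  set Kf : ℝ := 2 * r₂ * (2 * r₂ ^ 2 * (ℓ / r₁ ^ 4 + 2 * Mg / r₁ ^ 6) + (ℓ / r₁ ^ 2 + Mg / r₁ ^ 4)) * (4 + 2 * A) with hKf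
  have hKf0 : 0 ≤ Kf := by positivity
  have hKnn : 0 ≤ Bw * Kf + Lw * (Mg / r₁ ^ 2) := by positivity
  obtain ⟨f, hf⟩ : ∃ f : ℝ → ℝ → ℝ, ∀ ω e, f ω e = G (ω ^ 2 + e ^ 2) * (e ^ 2 - ω ^ 2) / (ω ^ 2 + e ^ 2) ^ 2 := ⟨_, fun _ _ => rfl⟩
  set eK : ℝ × ℝ → ℝ := fun p => frameLevel μ K (WithLp.toLp 2 ![p.1, p.2]) with heK
  -- the per-frequency weighted planar integrand and its square-cut version
  set F : MatsubaraIdx M → ℝ × ℝ → ℝ := fun i p => w p * f (matsubaraFreq β M i) (eK p) with hF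
  set h : MatsubaraIdx M → ℝ × ℝ → ℝ := fun i => (Icc (-π) π ×ˢ Icc (-π) π).indicator (F i) with hh
  have hfcont : Continuous fun p : ℝ × ℝ => f p.1 p.2 := by
    have := klph_f_continuous hbd hlip hin hr₁; refine this.congr fun p => ?_; simp only [hf]
  have heKc : Continuous eK := continuous_frameLevel_coord' (K := K) (μ := μ)
  have hFc : ∀ i, Continuous (F i) := fun i => hwc.mul (hfcont.comp (continuous_const.prodMk heKc))
  have hfb : ∀ ω e, |f ω e| ≤ Mg / r₁ ^ 2 := fun ω e => by rw [hf]; exact klph_f_abs_le hbd hin hr₁ ω e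
  have h1 : ∀ i x y, F i (x + 2 * π, y) = F i (x, y) := fun i x y => by
    simp only [hF, heK, hw1]
    exact congrArg (fun z => w (x, y) * f _ z) (frameLevel_coord_add_two_pi_fst (K := K) (μ := μ) (x, y))
  have h2 : ∀ i x y, F i (x, y + 2 * π) = F i (x, y) := fun i x y => by
    simp only [hF, heK, hw2]
    exact congrArg (fun z => w (x, y) * f _ z) (frameLevel_coord_add_two_pi_snd (K := K) (μ := μ) (x, y))
  have heKlip : ∀ p q : ℝ × ℝ, |eK p - eK q| ≤ (4 + 2 * A) * dist p q := by
    intro p q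
    have hκ : ∀ x : Fin 2 → ℝ, ‖fderiv ℝ (fun x : Fin 2 → ℝ => -K.eval x) x‖ ≤ 2 * A := fun x => by
      rw [← frameShift_toLp_eq_neg_eval]; exact norm_fderiv_frameShift_toLp_le hA x
    have h := abs_planarBand_sub_le hκ μ (0 : Fin 2 → ℝ) p q
    simp only [sub_zero] at h
    simp only [heK, frameLevel_coord_eq_planarBand]
    exact h
  have hflipK : ∀ i (p q : ℝ × ℝ), |f (matsubaraFreq β M i) (eK p) - f (matsubaraFreq β M i) (eK q)| ≤ Kf * dist p q := by
    intro i p q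
    have h := klph_f_lipschitz_level hbd hlip hin hout hr₁ hr₂.le (matsubaraFreq β M i) (eK p) (eK q)
    simp only [← hf] at h
    calc _ ≤ 2 * r₂ * (2 * r₂ ^ 2 * (ℓ / r₁ ^ 4 + 2 * Mg / r₁ ^ 6) + (ℓ / r₁ ^ 2 + Mg / r₁ ^ 4)) * |eK p - eK q| := h
      _ ≤ 2 * r₂ * (2 * r₂ ^ 2 * (ℓ / r₁ ^ 4 + 2 * Mg / r₁ ^ 6) + (ℓ / r₁ ^ 2 + Mg / r₁ ^ 4)) * ((4 + 2 * A) * dist p q) :=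
          mul_le_mul_of_nonneg_left (heKlip p q) (by positivity)
      _ = Kf * dist p q := by rw [hKf]; ring
  have hlipF : ∀ i (p q : ℝ × ℝ), ‖F i p - F i q‖ ≤ (Real.toNNReal (Bw * Kf + Lw * (Mg / r₁ ^ 2)) : ℝ) * dist p q := by
    intro i p q
    rw [Real.coe_toNNReal _ hKnn, Real.norm_eq_abs, hF]
    have e : w p * f (matsubaraFreq β M i) (eK p) - w q * f (matsubaraFreq β M i) (eK q) =
        w p * (f (matsubaraFreq β M i) (eK p) - f (matsubaraFreq β M i) (eK q)) + (w p - w q) * f (matsubaraFreq β M i) (eK q) := by ring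
    simp only
    rw [e]
    refine (abs_add_le _ _).trans ?_
    rw [abs_mul, abs_mul]
    have t1 : |w p| * |f (matsubaraFreq β M i) (eK p) - f (matsubaraFreq β M i) (eK q)| ≤ Bw * (Kf * dist p q) :=
      mul_le_mul (hwb p) (hflipK i p q) (abs_nonneg _) hBw
    have t2 : |w p - w q| * |f (matsubaraFreq β M i) (eK q)| ≤ Lw * dist p q * (Mg / r₁ ^ 2) :=
      mul_le_mul (hwlip p q) (hfb _ _) (abs_nonneg _) (by positivity)
    calc _ ≤ Bw * (Kf * dist p q) + Lw * dist p q * (Mg / r₁ ^ 2) := add_le_add t1 t2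
      _ = (Bw * Kf + Lw * (Mg / r₁ ^ 2)) * dist p q := by ring
  have hFh : ∀ i, ∀ p ∈ Icc (-π) π ×ˢ Icc (-π) π, F i p = h i p := fun i p hp => by simp only [hh, Set.indicator_of_mem hp]
  have hh0 : ∀ i, ∀ p ∉ Icc (-π) π ×ˢ Icc (-π) π, h i p = 0 := fun i p hp => by simp only [hh, Set.indicator_of_notMem hp]
  have hzero : ∀ i, r₂ ≤ |matsubaraFreq β M i| → ∀ p, F i p = 0 := fun i hi p => by
    simp only [hF, hf]; rw [klph_f_zero_of_freq hout hr₂.le hi _, mul_zero]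
  -- the planar bound (weighted)
  have hplanar := klpw_planar_rotation_weighted_le B hA hADt hlo hhi hβ hbd hlip hin hout hr₁ hr₂ hr₂r hM w v hvm hvp hvb hw
  have hint : ∀ i, ∫ p, h i p = ∫ q in {q : ℝ × ℝ | |q.1| < π ∧ |q.2| < π ∧ |frameLevel μ K (WithLp.toLp 2 ![q.1, q.2])| < r},
      w q * f (matsubaraFreq β M i) (eK q) := by
    intro i
    rw [hh, integral_indicator (measurableSet_Icc.prod measurableSet_Icc)]
    have := klpw_integral_square_weighted_eq_tube (K := K) (μ := μ) (r := r) hout hr₂.le hr₂r w (matsubaraFreq β M i)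
    simp only [hF, heK, hf]
    exact this
  have hB : ‖β⁻¹ • ∑ i : MatsubaraIdx M, ∫ p, h i p‖ ≤
      Bv * (2 * π * (π * Real.sqrt 2 / (B.Dtmin - 2 * A)) *
            ((2 * r₂ * (2 * r₂ * (2 * r₂ ^ 2 * (ℓ / r₁ ^ 4 + 2 * Mg / r₁ ^ 6) + (ℓ / r₁ ^ 2 + Mg / r₁ ^ 4)))) * (r₂ + 2 * Real.pi / β) / β) +
          β⁻¹ * ((r₂ * β / π + 1) * (2 * r₂ * (2 * π * (1 / (B.Dtmin - 2 * A) ^ 2 + Real.pi * Real.sqrt 2 * (2 + 4 * A) / (B.Dtmin - 2 * A) ^ 3) * r₂ *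
            (Mg / r₁ ^ 2))))) := by
    rw [smul_eq_mul, Real.norm_eq_abs]
    simp only [hint, heK, hf]
    exact hplanar
  have hmain := klfl_matsubara_latticeAverage_norm_le (E := ℝ) hβ hr₂.le hFc h1 h2 hlipF hFh hh0 hzero hB L
  rw [Real.coe_toNNReal _ hKnn] at hmain
  simp only [smul_eq_mul, Real.norm_eq_abs, hF, heK, hf] at hmain
  -- the lattice levels are the planar band at the lattice momenta
  have hlat : ∀ k : TorusSite 2 L, frameLevel μ K (WithLp.toLp 2 ![latticeMomentum L k 0, latticeMomentum L k 1]) = nambuXiCT L μ K k := by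
    intro k
    rw [EngineV8.nambuXiCT_eq_frameLevel L μ K k]
    congr 2
    funext i; fin_cases i <;> rfl
  simp only [hlat] at hmain
  rw [hKf] at hmain
  exact hmain

end Chart

end Summit.HubbardSuperconductivity.HubbardSuperconductivity.Theorems.KLRegimeSplit

end
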